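import Mathlib
import Summits.Ventures.PercRepro2.Defs
import Summits.Ventures.PercRepro2.CoinTraceBlock
import Summits.Ventures.PercRepro2.CoinTraceShift
import Summits.Ventures.PercRepro2.CoinTwoStarAbstract
import Summits.Ventures.PercRepro2.CoinTraceBlocks
import Summits.Ventures.PercRepro2.CoinGoodDecomp

/-!
# The abstract pendant lemma for TWO CHAINS of length 2 in the sign-provable regime (blind cell
PercRepro2, night-2 g3; proofs/NIGHT2-DARC.md §19.6)

`P = {w, v₁, v₂, v₃, v₄}` with `w → v₁ → v₂ → t`, `w → v₃ → v₄ → t`: the traces carrying mass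
satisfy `v₁ ∈ Z → v₂ ∈ Z`, `v₃ ∈ Z → v₄ ∈ Z` and `w ∈ Z → (v₁, v₂ ∈ Z) ∨ (v₃, v₄ ∈ Z)`, so the
pivotal family is `{A = wv₁v₂, B = wv₃v₄, C = wv₁v₂v₄, D = wv₂v₃v₄, P}`.  Under the subadditivity
`ρ_C ≤ ρ_A + ρ_B`, `ρ_D ≤ ρ_A + ρ_B` the pivotal weight has a nonnegative good decomposition over
the four cylinder families (`twoChains_rho_decomp`), and `goodDecomp_functional_nonneg` gives
`S′ ≥ 0` (`twoChains_functional_nonneg`).  The open pattern of NIGHT2-DARC.md §15.15 is the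
up-set `{C, P}` of the complementary regime.
-/

namespace Summit.Ventures.PercRepro2.Coin

section TwoChains

open Classical

variable {V : Type*} [DecidableEq V] {R : Type*} [Field R] [LinearOrder R] [IsStrictOrderedRing R]

omit [LinearOrder R] [IsStrictOrderedRing R] in
/-- The pointwise good decomposition of the pivotal weight on the two-chains family, with the
free coefficient `cZ`; `c : V → R` carries the four cylinder coefficients. -/
lemma twoChains_rho_decomp {w v₁ v₂ v₃ v₄ : V} (hwv₁ : w ≠ v₁) (hwv₂ : w ≠ v₂) (hwv₃ : w ≠ v₃)
    (hwv₄ : w ≠ v₄) (hv₁₂ : v₁ ≠ v₂) (hv₁₃ : v₁ ≠ v₃) (hv₁₄ : v₁ ≠ v₄) (hv₂₃ : v₂ ≠ v₃)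
    (hv₂₄ : v₂ ≠ v₄) (hv₃₄ : v₃ ≠ v₄) (μ ρ : Finset V → R) (cZ : R)
    (hμ0a : ∀ Z ∈ ({w, v₁, v₂, v₃, v₄} : Finset V).powerset, v₁ ∈ Z → v₂ ∉ Z → μ Z = 0)
    (hμ0b : ∀ Z ∈ ({w, v₁, v₂, v₃, v₄} : Finset V).powerset, v₃ ∈ Z → v₄ ∉ Z → μ Z = 0)
    (hμ0c : ∀ Z ∈ ({w, v₁, v₂, v₃, v₄} : Finset V).powerset, w ∈ Z → ¬ (v₁ ∈ Z ∧ v₂ ∈ Z) → ¬ (v₃ ∈ Z ∧ v₄ ∈ Z) → μ Z = 0)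
    (hρ1 : ∀ Z ∈ ({w, v₁, v₂, v₃, v₄} : Finset V).powerset, w ∉ Z → ρ Z = 1) {Z : Finset V} (hZ : Z ∈ ({w, v₁, v₂, v₃, v₄} : Finset V).powerset) :
    μ Z * ρ Z = μ Z * ((1 - ρ ({w, v₁, v₂, v₃, v₄} : Finset V)) * (if Disjoint Z {w} then (1 : R) else 0)
      + (ρ ({w, v₁, v₂, v₃, v₄} : Finset V) - ρ {w, v₁, v₂} - ρ {w, v₃, v₄} + cZ) *
          (if Disjoint Z {w} ∨ Z = ({w, v₁, v₂, v₃, v₄} : Finset V) then (1 : R) else 0)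
      + ∑ v ∈ ({v₁, v₂, v₃, v₄} : Finset V),
          (if v = v₁ then ρ {w, v₁, v₂} + ρ {w, v₃, v₄} - ρ {w, v₂, v₃, v₄} - cZ
           else if v = v₂ then ρ {w, v₂, v₃, v₄} - ρ {w, v₃, v₄}
           else if v = v₃ then ρ {w, v₁, v₂} + ρ {w, v₃, v₄} - ρ {w, v₁, v₂, v₄} - cZ
           else ρ {w, v₁, v₂, v₄} - ρ {w, v₁, v₂}) *
          (if Disjoint Z {w} ∨ v ∈ Z then (1 : R) else 0)
      + cZ) := by
  have hZP : Z ⊆ ({w, v₁, v₂, v₃, v₄} : Finset V) := Finset.mem_powerset.mp hZ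
  -- expand the sum over the four leaves
  rw [Finset.sum_insert (by simp [hv₁₂, hv₁₃, hv₁₄]), Finset.sum_insert (by simp [hv₂₃, hv₂₄]),
    Finset.sum_insert (by simp [hv₃₄]), Finset.sum_singleton]
  simp only [if_true, hv₁₂.symm, hv₁₃.symm, hv₁₄.symm, hv₂₃.symm, hv₂₄.symm, hv₃₄.symm, if_false]
  by_cases hw : w ∈ Z
  · have hd : ¬ Disjoint Z {w} := fun h => Finset.disjoint_singleton_right.mp h hw
    by_cases h1 : v₁ ∈ Z <;> by_cases h2 : v₂ ∈ Z <;> by_cases h3 : v₃ ∈ Z <;> by_cases h4 : v₄ ∈ Z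
    · -- top
      have hZe : Z = ({w, v₁, v₂, v₃, v₄} : Finset V) := by
        ext z
        constructor
        · exact fun h => hZP h
        · intro h
          simp only [Finset.mem_insert, Finset.mem_singleton] at h
          rcases h with rfl | rfl | rfl | rfl | rfl <;> assumption
      rw [if_neg hd, if_pos (Or.inr hZe), if_pos (Or.inr h1), if_pos (Or.inr h2),
        if_pos (Or.inr h3), if_pos (Or.inr h4), hZe]
      ring
    · -- `v₃ ∈ Z`, `v₄ ∉ Z`
      rw [hμ0b Z hZ h3 h4]; ring
    · -- `Z = {w, v₁, v₂, v₄}`: C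
      have hZe : Z = {w, v₁, v₂, v₄} := by
        ext z
        constructor
        · intro h
          have := hZP h
          simp only [Finset.mem_insert, Finset.mem_singleton] at this ⊢
          rcases this with rfl | rfl | rfl | rfl | rfl
          · exact Or.inl rfl
          · exact Or.inr (Or.inl rfl)
          · exact Or.inr (Or.inr (Or.inl rfl))
          · exact absurd h h3
          · exact Or.inr (Or.inr (Or.inr rfl))
        · intro h
          simp only [Finset.mem_insert, Finset.mem_singleton] at h
          rcases h with rfl | rfl | rfl | rfl <;> assumption
      have hZP' : Z ≠ ({w, v₁, v₂, v₃, v₄} : Finset V) := fun h => h3 (h ▸ (by simp))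
      rw [if_neg hd, if_neg (by rintro (h | h); exact hd h; exact hZP' h), if_pos (Or.inr h1),
        if_pos (Or.inr h2), if_neg (by rintro (h | h); exact hd h; exact h3 h), if_pos (Or.inr h4),
        hZe]
      ring
    · -- `Z = {w, v₁, v₂}`: A
      have hZe : Z = {w, v₁, v₂} := by
        ext z
        constructor
        · intro h
          have := hZP h
          simp only [Finset.mem_insert, Finset.mem_singleton] at this ⊢
          rcases this with rfl | rfl | rfl | rfl | rfl
          · exact Or.inl rfl
          · exact Or.inr (Or.inl rfl)
          · exact Or.inr (Or.inr rfl)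
          · exact absurd h h3
          · exact absurd h h4
        · intro h
          simp only [Finset.mem_insert, Finset.mem_singleton] at h
          rcases h with rfl | rfl | rfl <;> assumption
      have hZP' : Z ≠ ({w, v₁, v₂, v₃, v₄} : Finset V) := fun h => h3 (h ▸ (by simp))
      rw [if_neg hd, if_neg (by rintro (h | h); exact hd h; exact hZP' h), if_pos (Or.inr h1),
        if_pos (Or.inr h2), if_neg (by rintro (h | h); exact hd h; exact h3 h),
        if_neg (by rintro (h | h); exact hd h; exact h4 h), hZe]
      ring
    · rw [hμ0a Z hZ h1 h2]; ring
    · rw [hμ0a Z hZ h1 h2]; ring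
    · rw [hμ0a Z hZ h1 h2]; ring
    · rw [hμ0a Z hZ h1 h2]; ring
    · -- `Z = {w, v₂, v₃, v₄}`: D
      have hZe : Z = {w, v₂, v₃, v₄} := by
        ext z
        constructor
        · intro h
          have := hZP h
          simp only [Finset.mem_insert, Finset.mem_singleton] at this ⊢
          rcases this with rfl | rfl | rfl | rfl | rfl
          · exact Or.inl rfl
          · exact absurd h h1
          · exact Or.inr (Or.inl rfl)
          · exact Or.inr (Or.inr (Or.inl rfl))
          · exact Or.inr (Or.inr (Or.inr rfl))
        · intro h
          simp only [Finset.mem_insert, Finset.mem_singleton] at h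
          rcases h with rfl | rfl | rfl | rfl <;> assumption
      have hZP' : Z ≠ ({w, v₁, v₂, v₃, v₄} : Finset V) := fun h => h1 (h ▸ (by simp))
      rw [if_neg hd, if_neg (by rintro (h | h); exact hd h; exact hZP' h),
        if_neg (by rintro (h | h); exact hd h; exact h1 h), if_pos (Or.inr h2),
        if_pos (Or.inr h3), if_pos (Or.inr h4), hZe]
      ring
    · rw [hμ0b Z hZ h3 h4]; ring
    · -- `v₂ ∈ Z`, `v₁, v₃ ∉ Z`, `v₄ ∈ Z`: no complete route
      rw [hμ0c Z hZ hw (fun h => h1 h.1) (fun h => h3 h.1)]; ring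
    · rw [hμ0c Z hZ hw (fun h => h1 h.1) (fun h => h3 h.1)]; ring
    · -- `Z = {w, v₃, v₄}`: B
      have hZe : Z = {w, v₃, v₄} := by
        ext z
        constructor
        · intro h
          have := hZP h
          simp only [Finset.mem_insert, Finset.mem_singleton] at this ⊢
          rcases this with rfl | rfl | rfl | rfl | rfl
          · exact Or.inl rfl
          · exact absurd h h1
          · exact absurd h h2
          · exact Or.inr (Or.inl rfl)
          · exact Or.inr (Or.inr rfl)
        · intro h
          simp only [Finset.mem_insert, Finset.mem_singleton] at h
          rcases h with rfl | rfl | rfl <;> assumption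
      have hZP' : Z ≠ ({w, v₁, v₂, v₃, v₄} : Finset V) := fun h => h1 (h ▸ (by simp))
      rw [if_neg hd, if_neg (by rintro (h | h); exact hd h; exact hZP' h),
        if_neg (by rintro (h | h); exact hd h; exact h1 h),
        if_neg (by rintro (h | h); exact hd h; exact h2 h), if_pos (Or.inr h3),
        if_pos (Or.inr h4), hZe]
      ring
    · rw [hμ0b Z hZ h3 h4]; ring
    · rw [hμ0c Z hZ hw (fun h => h1 h.1) (fun h => h3 h.1)]; ring
    · rw [hμ0c Z hZ hw (fun h => h1 h.1) (fun h => h3 h.1)]; ring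
  · have hd : Disjoint Z {w} := Finset.disjoint_singleton_right.mpr hw
    rw [hρ1 Z hZ hw]
    simp only [hd, true_or, if_true]
    ring


/-- **The abstract pendant lemma for two chains of length 2 in the sign-provable regime.** -/
theorem twoChains_functional_nonneg {w v₁ v₂ v₃ v₄ : V} (hwv₁ : w ≠ v₁) (hwv₂ : w ≠ v₂)
    (hwv₃ : w ≠ v₃) (hwv₄ : w ≠ v₄) (hv₁₂ : v₁ ≠ v₂) (hv₁₃ : v₁ ≠ v₃) (hv₁₄ : v₁ ≠ v₄)
    (hv₂₃ : v₂ ≠ v₃) (hv₂₄ : v₂ ≠ v₄) (hv₃₄ : v₃ ≠ v₄) (μ x y xh yh ρ : Finset V → R) (cZ : R)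
    (hμ : ∀ Z ∈ ({w, v₁, v₂, v₃, v₄} : Finset V).powerset, 0 ≤ μ Z)
    (hμ0a : ∀ Z ∈ ({w, v₁, v₂, v₃, v₄} : Finset V).powerset, v₁ ∈ Z → v₂ ∉ Z → μ Z = 0)
    (hμ0b : ∀ Z ∈ ({w, v₁, v₂, v₃, v₄} : Finset V).powerset, v₃ ∈ Z → v₄ ∉ Z → μ Z = 0)
    (hμ0c : ∀ Z ∈ ({w, v₁, v₂, v₃, v₄} : Finset V).powerset, w ∈ Z → ¬ (v₁ ∈ Z ∧ v₂ ∈ Z) → ¬ (v₃ ∈ Z ∧ v₄ ∈ Z) → μ Z = 0)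
    (hx1 : ∀ Z : Finset V, Z ⊆ ({w, v₁, v₂, v₃, v₄} : Finset V) → x Z ≤ 1) (hy1 : ∀ Z : Finset V, Z ⊆ ({w, v₁, v₂, v₃, v₄} : Finset V) → y Z ≤ 1)
    (hxh1 : ∀ Z : Finset V, Z ⊆ ({w, v₁, v₂, v₃, v₄} : Finset V) → xh Z ≤ 1) (hyh1 : ∀ Z : Finset V, Z ⊆ ({w, v₁, v₂, v₃, v₄} : Finset V) → yh Z ≤ 1)
    (hxanti : ∀ Z Z' : Finset V, Z ⊆ Z' → Z' ⊆ ({w, v₁, v₂, v₃, v₄} : Finset V) → x Z' ≤ x Z)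
    (hyanti : ∀ Z Z' : Finset V, Z ⊆ Z' → Z' ⊆ ({w, v₁, v₂, v₃, v₄} : Finset V) → y Z' ≤ y Z)
    (hxhanti : ∀ Z Z' : Finset V, Z ⊆ Z' → Z' ⊆ ({w, v₁, v₂, v₃, v₄} : Finset V) → xh Z' ≤ xh Z)
    (hyhanti : ∀ Z Z' : Finset V, Z ⊆ Z' → Z' ⊆ ({w, v₁, v₂, v₃, v₄} : Finset V) → yh Z' ≤ yh Z)
    (hxh_le : ∀ Z : Finset V, Z ⊆ ({w, v₁, v₂, v₃, v₄} : Finset V) → xh Z ≤ x Z) (hyh_le : ∀ Z : Finset V, Z ⊆ ({w, v₁, v₂, v₃, v₄} : Finset V) → yh Z ≤ y Z)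
    (hxh_eq : ∀ Z : Finset V, Z ⊆ ({w, v₁, v₂, v₃, v₄} : Finset V) → w ∉ Z → xh Z = x Z)
    (hyh_eq : ∀ Z : Finset V, Z ⊆ ({w, v₁, v₂, v₃, v₄} : Finset V) → w ∉ Z → yh Z = y Z)
    (hρ1 : ∀ Z ∈ ({w, v₁, v₂, v₃, v₄} : Finset V).powerset, w ∉ Z → ρ Z = 1) (hρle : ρ ({w, v₁, v₂, v₃, v₄} : Finset V) ≤ 1)
    (hρAC : ρ {w, v₁, v₂} ≤ ρ {w, v₁, v₂, v₄}) (hρBD : ρ {w, v₃, v₄} ≤ ρ {w, v₂, v₃, v₄})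
    (hcZ0 : 0 ≤ cZ) (hcZ₁ : ρ {w, v₁, v₂} + ρ {w, v₃, v₄} - ρ ({w, v₁, v₂, v₃, v₄} : Finset V) ≤ cZ)
    (hcZ₂ : cZ ≤ ρ {w, v₁, v₂} + ρ {w, v₃, v₄} - ρ {w, v₂, v₃, v₄})
    (hcZ₃ : cZ ≤ ρ {w, v₁, v₂} + ρ {w, v₃, v₄} - ρ {w, v₁, v₂, v₄})
    (hPA : TracePA ({w, v₁, v₂, v₃, v₄} : Finset V) μ) (hCU₁ : TraceCUPA ({w, v₁, v₂, v₃, v₄} : Finset V) μ v₁) (hCU₂ : TraceCUPA ({w, v₁, v₂, v₃, v₄} : Finset V) μ v₂)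
    (hCU₃ : TraceCUPA ({w, v₁, v₂, v₃, v₄} : Finset V) μ v₃) (hCU₄ : TraceCUPA ({w, v₁, v₂, v₃, v₄} : Finset V) μ v₄) :
    0 ≤ ∑ Z ∈ ({w, v₁, v₂, v₃, v₄} : Finset V).powerset, μ Z * ρ Z *
      (xh Z * (∑ Z' ∈ ({w, v₁, v₂, v₃, v₄} : Finset V).powerset, μ Z') - ∑ Z' ∈ ({w, v₁, v₂, v₃, v₄} : Finset V).powerset, x Z' * μ Z') *
      (yh Z * (∑ Z' ∈ ({w, v₁, v₂, v₃, v₄} : Finset V).powerset, μ Z') - ∑ Z' ∈ ({w, v₁, v₂, v₃, v₄} : Finset V).powerset, y Z' * μ Z') := by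
  have hwP : w ∈ ({w, v₁, v₂, v₃, v₄} : Finset V) := by simp
  have hLP : ({v₁, v₂, v₃, v₄} : Finset V) ⊆ ({w, v₁, v₂, v₃, v₄} : Finset V) := by
    intro z hz
    simp only [Finset.mem_insert, Finset.mem_singleton] at hz ⊢
    rcases hz with rfl | rfl | rfl | rfl <;> simp
  refine goodDecomp_functional_nonneg ({w, v₁, v₂, v₃, v₄} : Finset V) hwP ({v₁, v₂, v₃, v₄} : Finset V) hLP μ x y xh yh ρ
    (1 - ρ ({w, v₁, v₂, v₃, v₄} : Finset V)) (ρ ({w, v₁, v₂, v₃, v₄} : Finset V) - ρ {w, v₁, v₂} - ρ {w, v₃, v₄} + cZ) cZ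
    (fun v => if v = v₁ then ρ {w, v₁, v₂} + ρ {w, v₃, v₄} - ρ {w, v₂, v₃, v₄} - cZ
      else if v = v₂ then ρ {w, v₂, v₃, v₄} - ρ {w, v₃, v₄}
      else if v = v₃ then ρ {w, v₁, v₂} + ρ {w, v₃, v₄} - ρ {w, v₁, v₂, v₄} - cZ
      else ρ {w, v₁, v₂, v₄} - ρ {w, v₁, v₂})
    hμ hx1 hy1 hxh1 hyh1 hxanti hyanti hxhanti hyhanti hxh_le hyh_le hxh_eq hyh_eq
    (by linarith) (by linarith) hcZ0 ?_
    (fun Z hZ => twoChains_rho_decomp hwv₁ hwv₂ hwv₃ hwv₄ hv₁₂ hv₁₃ hv₁₄ hv₂₃ hv₂₄ hv₃₄ μ ρ cZ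
      hμ0a hμ0b hμ0c hρ1 hZ)
    hPA ?_
  · intro v hv
    simp only [Finset.mem_insert, Finset.mem_singleton] at hv
    rcases hv with rfl | rfl | rfl | rfl
    · rw [if_pos rfl]; linarith
    · rw [if_neg hv₁₂.symm, if_pos rfl]; linarith
    · rw [if_neg hv₁₃.symm, if_neg hv₂₃.symm, if_pos rfl]; linarith
    · rw [if_neg hv₁₄.symm, if_neg hv₂₄.symm, if_neg hv₃₄.symm]; linarith
  · intro v hv
    simp only [Finset.mem_insert, Finset.mem_singleton] at hv
    rcases hv with rfl | rfl | rfl | rfl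
    · exact hCU₁
    · exact hCU₂
    · exact hCU₃
    · exact hCU₄

end TwoChains

end Summit.Ventures.PercRepro2.Coin
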